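/-
Copyright (c) 2026 the pub-hodgecm-mathlib formalisation cell (harness21).  Prover seat hodgecm-mathlib-A-p12 (g22), 2026-09-01.  Road «S3-tree» (architect A-p16 (g30)
A-94 (2) ∕ A-97 «P-1 ASSEMBLY»), brick T3′ «depth-zero κ-transfer», THE TYPE-(1) ASSEMBLY (part 2∕3: the G-side) — over the ★ organs of F0P3b-p01 (g11) (socket, unit row), A-p12 (g21)
(ROW-0), A-p19 (g25) (ROW-2), F0P3a-p03 (g15) (O8c H-values).
-/
import Literature.NumberTheory.Rogawski1990.DepthZeroKappaTransferTypeOneCounts              -- part 1∕3 (this seat): the three counts of a literal, `kappa_free_row`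
import Literature.NumberTheory.Rogawski1990.DepthZeroKappaTransferTypeOneSocket              -- ★ p845914 the socket `finsum_finExplicitDelta_mul_classOrbitalIntegral_eq_of_split_of_strata` (F0P3b-p01 (g11))
import Literature.NumberTheory.Rogawski1990.UnitFundamentalLemmaInertFlickerRepresentatives   -- ★ `exists_four_matched_flicker_representatives`, `conjLocal_finGammaTwo_mul_finGammaTwo`
import HarnessLib

/-!
# T3′ (P-1), TYPE ONE — part 2∕3: the G-side at a depth-zero piece (the socket fed with the counts of the matched representatives)

Topic `NumberTheory/Rogawski1990`; namespace `Literature.NumberTheory.Rogawski1990`.  Cell `pub/hodgecm-mathlib`, crux H413; road «S3-tree», brick T3′ «depth-zero κ-transfer»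
(DESIGN v2 §2 (P-1)); the assembly is part 3∕3.
HONEST LABEL: HC_CM is proved only modulo the cell's 2 remaining named inputs (hLiu418 24832, h413 24833) until rung 0 closes; this file asserts nothing printed — it is an
assembly of ★ organs.  THEOREMS ONLY (no definition, no instance, no notation, no named fact, no `sorry`); kernel lane `--supports stmt-HodgeConjecture-24833`.

THE STATEMENT (`finsum_finExplicitDelta_mul_classOrbitalIntegral_depthZero_eq_of_split`; frame = ★ the socket's VERBATIM up to its values).  For DEEP split eigen-data
(`α ≡ γ ≡ u_w ≡ 1 (mod 𝔪_w)`, `a(w) = α`, `d(w) = γ`, `N = ord_w(α − γ)`), a depth-zero piece `g` at the hyperspecial vertex (supported in `K`, `Ad K`-invariant, constant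
`= c r` on the residually-unipotent Jordan strata of `K`) and the canonical family `m_G` of a Haar measure `ν_G`:
  `Σᶠ_c Δ‴_v(γ_H, c)·Φ(c, g) = ν_G(K)·((q⁻²c₀ + ((q²−1)∕q²)c₁)·W(N−1) + (−q⁻¹c₁ + ((q+1)∕q)c₂)·(W(N) − W(N−1)))`.
THE PROOF.  ★ `exists_four_matched_flicker_representatives` fixes the strata counts `n i r` (literal 1 = `t_1(a,u,d)`, 2 = `t_π(a,u,d)`, 3 = `t_π(a,d,u)`, 4 = `t_π(u,a,d)`,
exponents `(Q₁,Q₂,P) = (N₁,N₂,N), (N₁,N₂,N), (N,N₂,N₁), (N₁,N,N₂)`); the socket's four values are ★ `classOrbitalIntegral_eq_mul_strata_of_congr_flickerTorusElt{,One}` at ANY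
congruent `t′`, whose counts agree with the representatives' through the closed forms (part 1 §3, ℕ-casts are injective); its three κ-sums are ★ `Flicker1998.flicker_theorem15` at
`(N₁,N₂,N)` and `(N₁−1,N₂−1,N−1)` and `kappa_free_row`.  The large goal is kept out of the eliminators' motives (`by_contra`), whence the heartbeat budget.

## References
* [Rogawski1990] J. D. Rogawski, *Automorphic Representations of Unitary Groups in Three Variables*, Ann. of Math. Stud. 123 (1990): §4.9 Prop. 4.9.1 (a)(b) pp. 54–55,
  Lemma 4.9.3 p. 56; §4.3 (4.3.1)–(4.3.2) p. 43; §8.1 Prop. 8.1.1 p. 112; §3.1 p. 19.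
* [Flicker1998UnitaryFL] Y. Z. Flicker, *Elementary proof of the fundamental lemma for a unitary group*, Canad. J. Math. 50 (1998): Prop. 3 p. 78, Props. 11–14 pp. 87–94,
  §6 Thm. 15 p. 95.
* [LanglandsShelstad1987] R. P. Langlands, D. Shelstad, *On the definition of transfer factors*, Math. Ann. 278 (1987): §1.3–1.4.
* [Kottwitz1986] R. Kottwitz, *Base change for unit elements of Hecke algebras*, Compositio Math. 60 (1986): §3.
-/

set_option autoImplicit false

noncomputable section

open MeasureTheory Measure Set Function NumberField IsDedekindDomain Matrix Polynomial Topology Filter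
open Literature.NumberTheory.Automorphic Literature.NumberTheory.Automorphic.UnitaryGroup
open Literature.NumberTheory.Automorphic.IntegralReduction Literature.NumberTheory.GaloisRepresentations
open scoped Matrix MatrixGroups ValuativeRel

namespace Literature.NumberTheory.Rogawski1990

/-! ## The G-side at a depth-zero piece -/

section GSide

variable (L : Type) [Field L] [NumberField L] [IsCMField L] {v : HeightOneSpectrum (𝓞 ↥(maximalRealSubfield L))} (H' : Matrix (Fin 3) (Fin 3) L)

set_option maxHeartbeats 4000000 in  -- nine instantiations of the ≈ 60-binder ★ count ∕ value ∕ socket heads (as in ★ `UnitFundamentalLemmaInertFlickerRepresentatives`)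
open scoped Classical in
/-- **THE G-SIDE OF THE TYPE-(1) CLAUSE AT A DEPTH-ZERO PIECE** (frame = ★ the socket's, verbatim up to its values): for DEEP split eigen-data (`α ≡ γ ≡ u_w ≡ 1`, `a(w) = α`,
`d(w) = γ`), a depth-zero piece `g` at the hyperspecial vertex and the canonical family `m_G` of a Haar measure `ν_G`,
`Σᶠ_c Δ‴_v(γ_H, c)·Φ(c, g) = ν_G(K)·((q⁻²c₀ + ((q²−1)∕q²)c₁)·W(N−1) + (−q⁻¹c₁ + ((q+1)∕q)c₂)·(W(N) − W(N−1)))`, `N = ord_w(α − γ)`.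
Proof: ★ `exists_four_matched_flicker_representatives` fixes the strata counts `n i r`; the socket's four values are ★ `classOrbitalIntegral_eq_mul_strata_of_congr_flickerTorusElt{,One}`
with the counts transported through their closed forms (§3); its three κ-sums are ★ `Flicker1998.flicker_theorem15` twice and `kappa_free_row`.
[cite: Rogawski1990, §4.9 Prop. 4.9.1 (a)(b) p. 55; §4.3 (4.3.1)–(4.3.2) p. 43] [cite: Flicker1998UnitaryFL, Prop. 3 p. 78; §6 Thm. 15 p. 95] [cite: Kottwitz1986, §3] -/
theorem finsum_finExplicitDelta_mul_classOrbitalIntegral_depthZero_eq_of_split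
    (hH' : (H'.map (IsCMField.complexConj L))ᵀ = H') (w : PlacesOver L v)
    (hw : IsCMField.complexConj L • w.1 = w.1) (hv : Algebra.IsUnramifiedIn (𝓞 L) v.asIdeal)
    (hH'w : IsUnit (placeForm H' w.1)) (hH'i : hH'w.unit ∈ glInt 3 (w.1.adicCompletion L))
    (μ : HeckeCharacter L) (hμ : μ.IsUnramifiedAt w.1)
    [∀ γ : ((cmDatum L 3 H').Local v), MeasurableSpace (((cmDatum L 3 H').Local v) ⧸ Subgroup.centralizer ({γ} : Set ((cmDatum L 3 H').Local v)))]
    (hl : ∀ (v : HeightOneSpectrum (𝓞 ↥(maximalRealSubfield L)))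
      (a : (cmDatum L 2 (Matrix.of fun i j : Fin 2 => if i.val + j.val + 1 = 2 then (1 : L) else 0)).Local v ×
      (cmDatum L 1 (Matrix.of fun i j : Fin 1 => if i.val + j.val + 1 = 1 then (1 : L) else 0)).Local v)
      (b : (cmDatum L 3 H').Local v)
      (x : (cmDatum L 2 (Matrix.of fun i j : Fin 2 => if i.val + j.val + 1 = 2 then (1 : L) else 0)).Local v ×
      (cmDatum L 1 (Matrix.of fun i j : Fin 1 => if i.val + j.val + 1 = 1 then (1 : L) else 0)).Local v),
      finExplicitDelta L v H' (x * a * x⁻¹) μ b = finExplicitDelta L v H' a μ b)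
    (hr : ∀ (v : HeightOneSpectrum (𝓞 ↥(maximalRealSubfield L)))
      (a : (cmDatum L 2 (Matrix.of fun i j : Fin 2 => if i.val + j.val + 1 = 2 then (1 : L) else 0)).Local v ×
      (cmDatum L 1 (Matrix.of fun i j : Fin 1 => if i.val + j.val + 1 = 1 then (1 : L) else 0)).Local v)
      (b y : (cmDatum L 3 H').Local v),
      finExplicitDelta L v H' a μ (y * b * y⁻¹) = finExplicitDelta L v H' a μ b)
    (hH'u : IsUnit H')
    (hμω : ∀ x : ideleGroup ↥(maximalRealSubfield L), μ (AdeleRing.ideleBaseChange ↥(maximalRealSubfield L) L x) = quadraticHeckeCharCM L x)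
    {γH : ((cmDatum L 2 (Matrix.of fun i j : Fin 2 => if i.val + j.val + 1 = 2 then (1 : L) else 0)).Local v ×
      (cmDatum L 1 (Matrix.of fun i j : Fin 1 => if i.val + j.val + 1 = 1 then (1 : L) else 0)).Local v)}
    -- the split eigen-data of `stub_splitExponents`
    (α γ : w.1.adicCompletion L) (N₁ N₂ : ℕ)
    (hα : ((((γH.1.val : GL (Fin 2) (LocalRing L v)) : Matrix (Fin 2) (Fin 2) (LocalRing L v)).charpoly).map
        (Pi.evalRingHom (fun w' : PlacesOver L v => w'.1.adicCompletion L) w)).IsRoot α)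
    (hγ : ((((γH.1.val : GL (Fin 2) (LocalRing L v)) : Matrix (Fin 2) (Fin 2) (LocalRing L v)).charpoly).map
        (Pi.evalRingHom (fun w' : PlacesOver L v => w'.1.adicCompletion L) w)).IsRoot γ)
    (hαγ : α ≠ γ)
    (hN₁ : Valued.v (α - finGammaTwo L v γH w) = WithZero.exp (-(N₁ : ℤ)))
    (hN₂ : Valued.v (γ - finGammaTwo L v γH w) = WithZero.exp (-(N₂ : ℤ)))
    -- Flicker's scalars (★ `exists_flicker_scalars_of_nonsplit`) and an eigenframe of `g` over `E_v` (★ (E1))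
    {e π π' x y a d : LocalRing L v} (h2e : 2 * e = 1) (hσπ : conjLocal L (IsCMField.complexConj L) v π = π) (hππ : π * π' = 1)
    (hπN : ∀ z : LocalRing L v, conjLocal L (IsCMField.complexConj L) v z * z ≠ π)
    (hx : conjLocal L (IsCMField.complexConj L) v x * x = 2) (hy : conjLocal L (IsCMField.complexConj L) v y * y = -2)
    (ha1 : conjLocal L (IsCMField.complexConj L) v a * a = 1) (hd1 : conjLocal L (IsCMField.complexConj L) v d * d = 1)
    {P₂ : GL (Fin 2) (LocalRing L v)} (hP₂ : (γH.1.val.val : Matrix (Fin 2) (Fin 2) (LocalRing L v)) * P₂.val = P₂.val * diagonal ![a, d])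
    (had : a ≠ d) (hab : a ≠ finGammaTwo L v γH) (hbd : finGammaTwo L v γH ≠ d)
    (hu0 : a w = α) (hu1w : d w = γ) (N : ℕ) (hN : Valued.v (α - γ) = WithZero.exp (-(N : ℤ)))
    (htri : (N₁ = N₂ ∧ N₁ ≤ N) ∨ (N₁ = N ∧ N₁ ≤ N₂) ∨ (N₂ = N ∧ N₂ ≤ N₁))
    (hα1 : Valued.v (α - 1) < 1) (hγ1 : Valued.v (γ - 1) < 1) (hb1 : Valued.v (finGammaTwo L v γH w - 1) < 1)
    (h2 : IsUnit (2 : 𝒪[w.1.adicCompletion L]))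
    [MeasurableSpace ((cmDatum L 3 H').Local v)] [BorelSpace ((cmDatum L 3 H').Local v)]
    [∀ γ : ((cmDatum L 3 H').Local v), BorelSpace (((cmDatum L 3 H').Local v) ⧸ Subgroup.centralizer ({γ} : Set ((cmDatum L 3 H').Local v)))]
    (νG : Measure ((cmDatum L 3 H').Local v)) [νG.IsHaarMeasure] [νG.IsMulRightInvariant]
    {mG : OrbitalMeasureFamily ((cmDatum L 3 H').Local v)}
    (hmG : mG.IsCanonical (fun γ => IsRegularElt (γ.val : GL (Fin 3) (UnitaryGroup.LocalRing L v))) νG)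
    (g : ((cmDatum L 3 H').Local v) → ℂ) (hg : IsLocSmooth g) (hgK : tsupport g ⊆ (cmLocalIntegralLevel L 3 H' v : Set ((cmDatum L 3 H').Local v)))
    (hginv : ∀ u ∈ cmLocalIntegralLevel L 3 H' v, ∀ x, g (u * x * u⁻¹) = g x)
    (c : ℕ → ℂ)
    (hc : ∀ k ∈ cmLocalIntegralLevel L 3 H' v,
      (redMat (((k.val : GL (Fin 3) (UnitaryGroup.LocalRing L v)).val.map (Pi.evalRingHom (fun w' : PlacesOver L v => w'.1.adicCompletion L) w))) - 1) ^ 3 = 0 →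
      g k = c (redMat (((k.val : GL (Fin 3) (UnitaryGroup.LocalRing L v)).val.map (Pi.evalRingHom (fun w' : PlacesOver L v => w'.1.adicCompletion L) w))) - 1).rank) :
    ∑ᶠ cG : ConjClasses ((cmDatum L 3 H').Local v),
        (finExplicitCollection L H' μ hl hr v).Δ γH (Quotient.out cG) * classOrbitalIntegral mG g cG =
      (νG.real (cmLocalIntegralLevel L 3 H' v : Set ((cmDatum L 3 H').Local v)) : ℂ) *
        (((((Ideal.absNorm v.asIdeal : ℂ)) ^ 2)⁻¹ * c 0 + ((((Ideal.absNorm v.asIdeal : ℂ)) ^ 2 - 1) / ((Ideal.absNorm v.asIdeal : ℂ)) ^ 2) * c 1) *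
          ((Flicker1998.phiH (Ideal.absNorm v.asIdeal) (N - 1) : ℚ) : ℂ) +
        (-((Ideal.absNorm v.asIdeal : ℂ))⁻¹ * c 1 + ((((Ideal.absNorm v.asIdeal : ℂ)) + 1) / ((Ideal.absNorm v.asIdeal : ℂ))) * c 2) *
          ((Flicker1998.phiH (Ideal.absNorm v.asIdeal) N - Flicker1998.phiH (Ideal.absNorm v.asIdeal) (N - 1) : ℚ) : ℂ)) := by
  have hq : 1 < Ideal.absNorm v.asIdeal :=
    Nat.one_lt_iff_ne_zero_and_ne_one.2 ⟨by rw [Ne, Ideal.absNorm_eq_zero_iff]; exact v.ne_bot,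
      by rw [Ne, Ideal.absNorm_eq_one_iff]; exact v.isPrime.ne_top⟩
  -- all exponents are `≥ 1` (deepness)
  have hdeep : ∀ {s t : w.1.adicCompletion L} {M : ℕ}, Valued.v (s - 1) < 1 → Valued.v (t - 1) < 1 →
      Valued.v (s - t) = WithZero.exp (-(M : ℤ)) → 1 ≤ M := by
    intro s t M hs ht hM
    have hlt : Valued.v (s - t) < 1 := by
      have e : s - t = (s - 1) - (t - 1) := by ring
      rw [e]; exact lt_of_le_of_lt (Valuation.map_sub _ _ _) (max_lt hs ht)
    rw [hM, ← WithZero.exp_zero, WithZero.exp_lt_exp] at hlt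
    omega
  have h₁ : 1 ≤ N₁ := hdeep hα1 hb1 hN₁
  have h₂ : 1 ≤ N₂ := hdeep hγ1 hb1 hN₂
  have hN1 : 1 ≤ N := hdeep hα1 hγ1 hN
  have htri' : (N₁ - 1 = N₂ - 1 ∧ N₁ - 1 ≤ N - 1) ∨ (N₁ - 1 = N - 1 ∧ N₁ - 1 ≤ N₂ - 1) ∨ (N₂ - 1 = N - 1 ∧ N₂ - 1 ≤ N₁ - 1) := by omega
  have hbb : conjLocal L (IsCMField.complexConj L) v (finGammaTwo L v γH) * finGammaTwo L v γH = 1 := conjLocal_finGammaTwo_mul_finGammaTwo L v γH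
  -- depths and exponents read at `w` in the three orderings of the literals
  have hd_a : Valued.v (a w - 1) < 1 := by rw [hu0]; exact hα1
  have hd_d : Valued.v (d w - 1) < 1 := by rw [hu1w]; exact hγ1
  have hP_ad : Valued.v (a w - d w) = WithZero.exp (-(N : ℤ)) := by rw [hu0, hu1w]; exact hN
  have hQ_ab : Valued.v (a w - finGammaTwo L v γH w) = WithZero.exp (-(N₁ : ℤ)) := by rw [hu0]; exact hN₁
  have hQ_db : Valued.v (d w - finGammaTwo L v γH w) = WithZero.exp (-(N₂ : ℤ)) := by rw [hu1w]; exact hN₂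
  have hQ_bd : Valued.v (finGammaTwo L v γH w - d w) = WithZero.exp (-(N₂ : ℤ)) := by rw [Valuation.map_sub_swap]; exact hQ_db
  have hQ_ba : Valued.v (finGammaTwo L v γH w - a w) = WithZero.exp (-(N₁ : ℤ)) := by rw [Valuation.map_sub_swap]; exact hQ_ab
  have hQ_da : Valued.v (d w - a w) = WithZero.exp (-(N : ℤ)) := by rw [Valuation.map_sub_swap]; exact hP_ad
  -- keep the goal out of the eliminators' motives while gathering the representatives
  by_contra hneg
  -- (3) the matched representatives of the four literals
  obtain ⟨Tl, ψ, t₁, t₂, t₃, t₄, τ₁, τ₂, τ₃, τ₄, Pf, P₁, dπ, g₃, g₄, hform, hψ, -, hlevR, -, -, -, -, -, -, -, -, -, hψ1, hψ2, hψ3, hψ4,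
    hτ₁, -, -, -, -, -, -, hτ₂, hτ₃, hτ₄, -, -⟩ :=
    exists_four_matched_flicker_representatives L H' hH' w hw hv hH'w hH'i h2e hσπ hππ hπN hx hy ha1 hd1 hP₂ had hab hbd
  have hlit1 : (ψ t₁).val.val = !![e * (a + d), 0, -(e * (a - d)); 0, finGammaTwo L v γH, 0; -(e * (a - d)), 0, e * (a + d)] := by
    rw [hψ1, hτ₁]
  have hlit2 : (ψ t₂).val.val = !![e * (a + d), 0, -(e * (a - d) * π); 0, finGammaTwo L v γH, 0;
      -(e * (a - d) * π'), 0, e * (a + d)] := by rw [hψ2, hτ₂]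
  have hlit3 : (ψ t₃).val.val = !![e * (a + finGammaTwo L v γH), 0, -(e * (a - finGammaTwo L v γH) * π); 0, d, 0;
      -(e * (a - finGammaTwo L v γH) * π'), 0, e * (a + finGammaTwo L v γH)] := by rw [hψ3, hτ₃]
  have hlit4 : (ψ t₄).val.val = !![e * (finGammaTwo L v γH + d), 0, -(e * (finGammaTwo L v γH - d) * π); 0, a, 0;
      -(e * (finGammaTwo L v γH - d) * π'), 0, e * (finGammaTwo L v γH + d)] := by rw [hψ4, hτ₄]
  -- the counts at the representatives: literal 1 = t_1(a,b,d); 2 = t_π(a,b,d); 3 = t_π(a,d,b); 4 = t_π(b,a,d)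
  obtain ⟨c10, c12, c1s⟩ := rankStrata_counts_of_congr_flickerTorusEltOne L H' hH' hH'u w hw hv hH'w hH'i h2 h2e hy ha1 hbb hd1 hab hbd had
    Tl hform ψ t₁ hψ hlevR hlit1 hP_ad hQ_ab hQ_db htri hd_a hb1 hd_d
  obtain ⟨c20, c22, c2s⟩ := rankStrata_counts_of_congr_flickerTorusElt L H' hH' hH'u w hw hv hH'w hH'i h2 h2e hσπ hππ hπN hy ha1 hbb hd1 hab hbd had
    Tl hform ψ t₂ hψ hlevR hlit2 hP_ad hQ_ab hQ_db hd_a hb1 hd_d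
  obtain ⟨c30, c32, c3s⟩ := rankStrata_counts_of_congr_flickerTorusElt L H' hH' hH'u w hw hv hH'w hH'i h2 h2e hσπ hππ hπN hy ha1 hd1 hbb had hbd.symm hab
    Tl hform ψ t₃ hψ hlevR hlit3 hQ_ab hP_ad hQ_bd hd_a hd_d hb1
  obtain ⟨c40, c42, c4s⟩ := rankStrata_counts_of_congr_flickerTorusElt L H' hH' hH'u w hw hv hH'w hH'i h2 h2e hσπ hππ hπN hy hbb ha1 hd1 hab.symm had hbd
    Tl hform ψ t₄ hψ hlevR hlit4 hQ_bd hQ_ba hQ_da hb1 hd_a hd_d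
  -- the strata-count function of the socket
  let nS : ((cmDatum L 3 H').Local v) → ℕ → ℕ := fun t r => {q : (cmDatum L 3 H').Local v ⧸ cmLocalIntegralLevel L 3 H' v |
        q ∈ MulAction.fixedBy ((cmDatum L 3 H').Local v ⧸ cmLocalIntegralLevel L 3 H' v) t ∧
          (redMat ((((q.out⁻¹ * t * q.out : (cmDatum L 3 H').Local v)).val : GL (Fin 3) (LocalRing L v)).val.map
            (Pi.evalRingHom (fun w' : PlacesOver L v => w'.1.adicCompletion L) w)) - 1).rank = r}.ncard
  let n : Fin 4 → ℕ → ℕ := fun i => if i = 0 then nS t₁ else if i = 1 then nS t₂ else if i = 2 then nS t₃ else nS t₄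
  have hn0 : n 0 = nS t₁ := rfl
  have hn1 : n 1 = nS t₂ := rfl
  have hn2 : n 2 = nS t₃ := rfl
  have hn3 : n 3 = nS t₄ := rfl
  -- (5) the three κ-sums of the counts
  have hK : ((n 0 0 + n 0 1 + n 0 2 + (n 1 0 + n 1 1 + n 1 2) : ℕ) : ℚ) - ((n 2 0 + n 2 1 + n 2 2 + (n 3 0 + n 3 1 + n 3 2) : ℕ) : ℚ) =
      (-(Ideal.absNorm v.asIdeal : ℚ)) ^ (N₁ + N₂) * Flicker1998.phiH (Ideal.absNorm v.asIdeal) N := by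
    have h15 := Flicker1998.flicker_theorem15 hq htri
    rw [Flicker1998.phiKappa] at h15
    rw [hn0, hn1, hn2, hn3]
    push_cast
    change ((nS t₁ 0 : ℚ) + nS t₁ 1 + nS t₁ 2 + ((nS t₂ 0 : ℚ) + nS t₂ 1 + nS t₂ 2)) -
        ((nS t₃ 0 : ℚ) + nS t₃ 1 + nS t₃ 2 + ((nS t₄ 0 : ℚ) + nS t₄ 1 + nS t₄ 2)) = _
    rw [c1s, c2s, c3s, c4s, ← h15]
    ring
  have hK₀ : ((n 0 0 + n 1 0 : ℕ) : ℚ) - ((n 2 0 + n 3 0 : ℕ) : ℚ) =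
      (-(Ideal.absNorm v.asIdeal : ℚ)) ^ (N₁ + N₂ - 2) * Flicker1998.phiH (Ideal.absNorm v.asIdeal) (N - 1) := by
    have h15 := Flicker1998.flicker_theorem15 hq htri'
    rw [Flicker1998.phiKappa, show N₁ - 1 + (N₂ - 1) = N₁ + N₂ - 2 by omega] at h15
    rw [hn0, hn1, hn2, hn3]
    push_cast
    change ((nS t₁ 0 : ℚ) + nS t₂ 0) - ((nS t₃ 0 : ℚ) + nS t₄ 0) = _
    rw [c10, c20, c30, c40, ← h15]
    ring
  have hK₂ : ((n 0 2 + n 1 2 : ℕ) : ℚ) - ((n 2 2 + n 3 2 : ℕ) : ℚ) =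
      (-1 : ℚ) ^ (N₁ + N₂) * ((Ideal.absNorm v.asIdeal : ℚ) + 1) ^ 2 * (Ideal.absNorm v.asIdeal : ℚ) ^ (N₁ + N₂ + N - 2) := by
    rw [hn0, hn1, hn2, hn3, Nat.cast_add, Nat.cast_add]
    change ((nS t₁ 2 : ℚ) + nS t₂ 2) - ((nS t₃ 2 : ℚ) + nS t₄ 2) = _
    rw [c12, c22, c32, c42]
    exact kappa_free_row (Ideal.absNorm v.asIdeal) N₁ N₂ N
  -- the counts are literal-invariants: any other `t′` congruent to the same literal has the same three counts
  have hinv : ∀ (t t' : (cmDatum L 3 H').Local v) (F0 F2 S : ℚ),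
      ((nS t 0 : ℚ) = F0 ∧ (nS t 2 : ℚ) = F2 ∧ (nS t 0 : ℚ) + nS t 1 + nS t 2 = S) →
      ((nS t' 0 : ℚ) = F0 ∧ (nS t' 2 : ℚ) = F2 ∧ (nS t' 0 : ℚ) + nS t' 1 + nS t' 2 = S) →
      (nS t' 0 : ℂ) = nS t 0 ∧ (nS t' 1 : ℂ) = nS t 1 ∧ (nS t' 2 : ℂ) = nS t 2 := by
    rintro t t' F0 F2 S ⟨a0, a2, as⟩ ⟨b0, b2, bs⟩
    have e0 : nS t' 0 = nS t 0 := by exact_mod_cast b0.trans a0.symm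
    have e2 : nS t' 2 = nS t 2 := by exact_mod_cast b2.trans a2.symm
    have e1 : nS t' 1 = nS t 1 := by
      have : (nS t' 1 : ℚ) = nS t 1 := by
        have h1 := bs.trans as.symm
        push_cast [e0, e2] at h1
        linarith
      exact_mod_cast this
    exact ⟨by rw [e0], by rw [e1], by rw [e2]⟩
  -- (4) the SOCKET with `M = ν_G(K)`
  have hsock := finsum_finExplicitDelta_mul_classOrbitalIntegral_eq_of_split_of_strata L H' hH' w hw hv hH'w hH'i μ hμ
    (finExplicitDelta_conj_left_all L H' μ) (finExplicitDelta_conj_right_all L H' μ) hH'u hμω α γ N₁ N₂ hα hγ hαγ hN₁ hN₂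
    h2e hσπ hππ hπN hx hy ha1 hd1 hP₂ had hab hbd mG g N hN1 h₁ h₂ hq
    (νG.real (cmLocalIntegralLevel L 3 H' v : Set ((cmDatum L 3 H').Local v)) : ℂ) c n hK hK₀ hK₂
    (fun Tl' ψ' t' hform' hψ' hlev' hlit' => by
      obtain ⟨e0, e1, e2⟩ := hinv t₁ t' _ _ _ ⟨c10, c12, c1s⟩
        (rankStrata_counts_of_congr_flickerTorusEltOne L H' hH' hH'u w hw hv hH'w hH'i h2 h2e hy ha1 hbb hd1 hab hbd had
          Tl' hform' ψ' t' hψ' hlev' hlit' hP_ad hQ_ab hQ_db htri hd_a hb1 hd_d)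
      rw [classOrbitalIntegral_eq_mul_strata_of_congr_flickerTorusEltOne L H' hH' hH'u w hw νG hmG g hg hgK hginv c hc h2e ha1 hbb hd1 hab hbd had
        Tl' ψ' t' hψ' hlit' hd_a hb1 hd_d, hn0]
      rw [← e0, ← e1, ← e2])
    (fun Tl' ψ' t' hform' hψ' hlev' hlit' => by
      obtain ⟨e0, e1, e2⟩ := hinv t₂ t' _ _ _ ⟨c20, c22, c2s⟩
        (rankStrata_counts_of_congr_flickerTorusElt L H' hH' hH'u w hw hv hH'w hH'i h2 h2e hσπ hππ hπN hy ha1 hbb hd1 hab hbd had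
          Tl' hform' ψ' t' hψ' hlev' hlit' hP_ad hQ_ab hQ_db hd_a hb1 hd_d)
      rw [classOrbitalIntegral_eq_mul_strata_of_congr_flickerTorusElt L H' hH' hH'u w hw νG hmG g hg hgK hginv c hc h2e hππ ha1 hbb hd1 hab hbd had
        Tl' ψ' t' hψ' hlit' hd_a hb1 hd_d, hn1]
      rw [← e0, ← e1, ← e2])
    (fun Tl' ψ' t' hform' hψ' hlev' hlit' => by
      obtain ⟨e0, e1, e2⟩ := hinv t₃ t' _ _ _ ⟨c30, c32, c3s⟩
        (rankStrata_counts_of_congr_flickerTorusElt L H' hH' hH'u w hw hv hH'w hH'i h2 h2e hσπ hππ hπN hy ha1 hd1 hbb had hbd.symm hab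
          Tl' hform' ψ' t' hψ' hlev' hlit' hQ_ab hP_ad hQ_bd hd_a hd_d hb1)
      rw [classOrbitalIntegral_eq_mul_strata_of_congr_flickerTorusElt L H' hH' hH'u w hw νG hmG g hg hgK hginv c hc h2e hππ ha1 hd1 hbb had hbd.symm hab
        Tl' ψ' t' hψ' hlit' hd_a hd_d hb1, hn2]
      rw [← e0, ← e1, ← e2])
    (fun Tl' ψ' t' hform' hψ' hlev' hlit' => by
      obtain ⟨e0, e1, e2⟩ := hinv t₄ t' _ _ _ ⟨c40, c42, c4s⟩
        (rankStrata_counts_of_congr_flickerTorusElt L H' hH' hH'u w hw hv hH'w hH'i h2 h2e hσπ hππ hπN hy hbb ha1 hd1 hab.symm had hbd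
          Tl' hform' ψ' t' hψ' hlev' hlit' hQ_bd hQ_ba hQ_da hb1 hd_a hd_d)
      rw [classOrbitalIntegral_eq_mul_strata_of_congr_flickerTorusElt L H' hH' hH'u w hw νG hmG g hg hgK hginv c hc h2e hππ hbb ha1 hd1 hab.symm had hbd
        Tl' ψ' t' hψ' hlit' hb1 hd_a hd_d, hn3]
      rw [← e0, ← e1, ← e2])
  exact hneg hsock

end GSide

end Literature.NumberTheory.Rogawski1990

end
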